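import Summits.FinalStateConjecture.FinalStateConjecture.Theses.SignedCensus
import HarnessLib

/-!
# Birth skeleton — crux stmt-FinalStateConjecture-10825 `Theses.SignedCensus.ClosedUnderRotation` (crux, rank 2)
# line `birth` (skeleton registrar planner-skel-stmt-FinalStateConjecture-10825-0, 2026-08-17; BC3 of run/shared/lean/lens3/_common/BC.md)

The crux (rev 3, verbatim the route decl): for every level `s > 0`, if typed smooth no-hair `P s'` holds at every level
`0 ≤ s' < s` then `P s` holds, where `P s` says that every typed-regular (globally hyperbolic carrier, `Set.range 𝓑.embed` a
Cauchy hypersurface, connected non-degenerate future event horizon `𝓔⁺`, stationary Killing field `T` normalised to `−1` along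
the end) Ricci-flat `𝓑 : StationaryAFBlackHole` with `g(T,T) ≤ s` on `𝓔⁺` has domain of outer communications `C^∞`-isometric
to a subextremal Kerr exterior.

THE CUT (three named stubs, each a consequence of the target `GradedNoHair`, none implying the crux or the summit cheaply).
Fix `s > 0`, the induction hypothesis below `s`, and a hole `𝓑` of level `≤ s`; let `ℓ = g(T,T)|𝓔⁺` (`𝓔⁺ ≠ ∅` by connectedness).
* (B1) SOME generator is slower, `ℓ(p₀) < s`:  `stub_levelDeflation` (D) produces a typed-regular Ricci-flat hole `𝓑'` of level
  `≤ s'` for the intermediate level `s' = (max ℓ(p₀) 0 + s)/2 ∈ [0, s)`, whose Kerr-ness implies that of `𝓑`; the induction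
  hypothesis at `s'` makes `𝓑'` Kerr.  This is the refuters' LEVEL-DEFLATION observation on this item (carrier surgery shrinks the
  horizon and keeps the d.o.c.; evidence EVIDENCE2.md, KerrLevel.lean) turned from a misstatement witness into the proof device the
  typed statement actually admits: as typed, left-closedness has NO fold-exclusion content in case (B1).
* (B2) NO generator is slower, `ℓ ≡ s` on `𝓔⁺` (isolevel horizon): deflation is impossible and the induction hypothesis is mute;
  `stub_subluminalHorizon` (S: every typed-regular vacuum hole has `sup ℓ < 1`) forces `s < 1`, and `stub_isolevelRigidity` (I)
  is exactly the rigidity residue: an isorotating non-degenerate vacuum horizon at level `s ∈ (0,1)` bounds a Kerr d.o.c.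
`ClosedUnderRotation_of : Sig.D → Sig.S → Sig.I → ClosedUnderRotation` is the kernel-checked case analysis (real proof, no
`sorry`); `closedUnderRotation_of_stubs : ClosedUnderRotation` is the crux BY NAME modulo the three stubs.  The `Sig.*` legend
defs are the stub signatures verbatim (generated from one source string each); the registered stubs are def-free and
self-contained via `open … in`.

RELATION TO THE ROUTE.  The card's intended mechanism for this crux (K3: no fold / odd-state exclusion off the Kerr curve;
layer-2 children NoFoldOffKerr, KerrProperlyEmbedded) lives on the moduli space `𝔐` of definition request D1, not yet in the
tree, and — by level deflation — is NOT what the rev-3 typing expresses: under the refuters' proposed repair C′ (compact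
`Set.range 𝓑.embed ∩ 𝓔⁺` and `𝓔⁺ ⊆ stationaryOrbit T (Set.range 𝓑.embed ∩ 𝓔⁺)`) stub D becomes false, case (B1) regains its
fold-exclusion content, and S and I transfer verbatim with the two clauses added.  This file is the birth certificate of the crux
AS FILED.  Disproof.lean: none exists for this crux (`ledger crux ls` empty at registration; no `_false_without_` obligations).
Negatives index (1 entry, `not_UniformPhotonSphereChannels`): unrelated.
-/

set_option linter.dupNamespace false

noncomputable section

open scoped Manifold ContDiff Topology
open Filter Set Function Literature.Geometry.Lorentzian

namespace Summit.FinalStateConjecture.FinalStateConjecture.Cruxes.ClosedUnderRotation.Birth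

open Summit.FinalStateConjecture.FinalStateConjecture.Theses.SignedCensus (ClosedUnderRotation)

/-! ## Legend: the three stub statements as named propositions (verbatim the registered signatures) -/

/-- Statement of `stub_levelDeflation` (D): a typed-regular vacuum hole with a generator of level `< s'` (`s' > 0`) has a typed-regular vacuum companion of level `≤ s'` whose Kerr-ness implies its own. -/
def Sig.stub_levelDeflation : Prop :=
  open Literature.Geometry.Lorentzian in open scoped Manifold in ∀ (𝓑 : StationaryAFBlackHole.{0}) [𝓑.metric.HasLeviCivita] [Kerr.Facts] (hF : 𝓑.metric.isOpen_chronologicalFuture 𝓑.timeOrientation) (hP : 𝓑.metric.isOpen_chronologicalPast 𝓑.timeOrientation), 𝓑.metric.IsGloballyHyperbolic 𝓑.timeOrientation → 𝓑.metric.IsCauchyHypersurface 𝓑.timeOrientation (Set.range 𝓑.embed) → IsConnected 𝓑.horizon → 𝓑.toSpacetime.IsNonDegenerateHorizon 𝓑.Mext → Filter.Tendsto (fun x ↦ 𝓑.metric.val (𝓑.embed x) (𝓑.killing (𝓑.embed x)) (𝓑.killing (𝓑.embed x))) (⨅ R : ℝ, Filter.principal (𝓑.e.far R)) (nhds (-1))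 → 𝓑.metric.toPseudoRiemannianMetric.IsRicciFlat → ∀ s' : ℝ, 0 < s' → (∃ p₀ ∈ 𝓑.horizon, 𝓑.metric.val p₀ (𝓑.killing p₀) (𝓑.killing p₀) < s') → ∃ (𝓑' : StationaryAFBlackHole.{0}) (_ : 𝓑'.metric.HasLeviCivita) (hF' : 𝓑'.metric.isOpen_chronologicalFuture 𝓑'.timeOrientation) (hP' : 𝓑'.metric.isOpen_chronologicalPast 𝓑'.timeOrientation), 𝓑'.metric.IsGloballyHyperbolic 𝓑'.timeOrientation ∧ 𝓑'.metric.IsCauchyHypersurface 𝓑'.timeOrientation (Set.range 𝓑'.embed) ∧ IsConnected 𝓑'.horizon ∧ 𝓑'.toSpacetime.IsNonDegenerateHorizon 𝓑'.Mext ∧ Filter.Tendsto (fun x ↦ 𝓑'.metric.val (𝓑'.embed x) (𝓑'.killing (𝓑'.embed x)) (𝓑'.killing (𝓑'.embed x))) (⨅ R : ℝ, Filter.principal (𝓑'.e.far R)) (nhds (-1)) ∧ 𝓑'.metric.toPseudoRiemannianMetric.IsRicciFlat ∧ (∀ p ∈ 𝓑'.horizon, 𝓑'.metric.val p (𝓑'.killing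 p) (𝓑'.killing p) ≤ s') ∧ ((∃ (M a : ℝ) (_ : Kerr.IsSubextremal M a) (Φ : Diffeomorph (𝓡 4) 𝓘(ℝ, E4) (𝓑'.docOpens hF' hP') (Kerr.exterior M a) ((⊤ : ℕ∞) : WithTop ℕ∞)), ∀ (y : 𝓑'.docOpens hF' hP') (v w : EuclideanSpace ℝ (Fin 4)), (Kerr.smoothMetric M a (Kerr.rPlus M a)).val (Φ y) (mfderiv (𝓡 4) 𝓘(ℝ, E4) Φ y v) (mfderiv (𝓡 4) 𝓘(ℝ, E4) Φ y w) = 𝓑'.metric.val y.1 v w) → (∃ (M a : ℝ) (_ : Kerr.IsSubextremal M a) (Φ : Diffeomorph (𝓡 4) 𝓘(ℝ, E4) (𝓑.docOpens hF hP) (Kerr.exterior M a) ((⊤ : ℕ∞) : WithTop ℕ∞)), ∀ (y : 𝓑.docOpens hF hP) (v w : EuclideanSpace ℝ (Fin 4)), (Kerr.smoothMetric M a (Kerr.rPlus M a)).val (Φ y) (mfderiv (𝓡 4) 𝓘(ℝ, E4) Φ y v) (mfderiv (𝓡 4) 𝓘(ℝ, E4) Φ y w) = 𝓑.metric.val y.1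 v w))

/-- Statement of `stub_subluminalHorizon` (S): the horizon level of a typed-regular vacuum hole is uniformly `< 1`. -/
def Sig.stub_subluminalHorizon : Prop :=
  open Literature.Geometry.Lorentzian in open scoped Manifold in ∀ (𝓑 : StationaryAFBlackHole.{0}) [𝓑.metric.HasLeviCivita], 𝓑.metric.IsGloballyHyperbolic 𝓑.timeOrientation → 𝓑.metric.IsCauchyHypersurface 𝓑.timeOrientation (Set.range 𝓑.embed) → IsConnected 𝓑.horizon → 𝓑.toSpacetime.IsNonDegenerateHorizon 𝓑.Mext → Filter.Tendsto (fun x ↦ 𝓑.metric.val (𝓑.embed x) (𝓑.killing (𝓑.embed x)) (𝓑.killing (𝓑.embed x))) (⨅ R : ℝ, Filter.principal (𝓑.e.far R)) (nhds (-1)) → 𝓑.metric.toPseudoRiemannianMetric.IsRicciFlat → ∃ s₁ : ℝ, s₁ < 1 ∧ ∀ p ∈ 𝓑.horizon, 𝓑.metric.val p (𝓑.killing p) (𝓑.killing p) ≤ s₁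

/-- Statement of `stub_isolevelRigidity` (I): an isolevel (`g(T,T) ≡ s`, `0 < s < 1`) typed-regular vacuum hole has Kerr d.o.c. -/
def Sig.stub_isolevelRigidity : Prop :=
  open Literature.Geometry.Lorentzian in open scoped Manifold in ∀ s : ℝ, 0 < s → s < 1 → ∀ (𝓑 : StationaryAFBlackHole.{0}) [𝓑.metric.HasLeviCivita] [Kerr.Facts] (hF : 𝓑.metric.isOpen_chronologicalFuture 𝓑.timeOrientation) (hP : 𝓑.metric.isOpen_chronologicalPast 𝓑.timeOrientation), 𝓑.metric.IsGloballyHyperbolic 𝓑.timeOrientation → 𝓑.metric.IsCauchyHypersurface 𝓑.timeOrientation (Set.range 𝓑.embed) → IsConnected 𝓑.horizon → 𝓑.toSpacetime.IsNonDegenerateHorizon 𝓑.Mext → Filter.Tendsto (fun x ↦ 𝓑.metric.val (𝓑.embed x) (𝓑.killing (𝓑.embed x)) (𝓑.killing (𝓑.embed x))) (⨅ R : ℝ, Filter.principal (𝓑.e.far R)) (nhds (-1)) → (∀ p ∈ 𝓑.horizon, 𝓑.metric.val p (𝓑.killing p) (𝓑.killing p) = s) → 𝓑.metric.toPseudoRiemannianMetric.IsRicciFlat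 → ∃ (M a : ℝ) (_ : Kerr.IsSubextremal M a) (Φ : Diffeomorph (𝓡 4) 𝓘(ℝ, E4) (𝓑.docOpens hF hP) (Kerr.exterior M a) ((⊤ : ℕ∞) : WithTop ℕ∞)), ∀ (y : 𝓑.docOpens hF hP) (v w : EuclideanSpace ℝ (Fin 4)), (Kerr.smoothMetric M a (Kerr.rPlus M a)).val (Φ y) (mfderiv (𝓡 4) 𝓘(ℝ, E4) Φ y v) (mfderiv (𝓡 4) 𝓘(ℝ, E4) Φ y w) = 𝓑.metric.val y.1 v w

/-! ## Registered stubs (`sorry` only here; signatures def-free and self-contained) -/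

/-- **D — LEVEL DEFLATION BY HORIZON SURGERY** (size L; Lorentzian causal geometry, no rigidity).  For every
typed-regular (globally hyperbolic carrier, `Set.range 𝓑.embed` a Cauchy hypersurface, connected non-degenerate `𝓔⁺`,
`T` normalised) Ricci-flat hole `𝓑` and every target level `s' > 0` exceeding the level `g(T,T)(p₀)` of SOME horizon point `p₀`,
there is a typed-regular Ricci-flat hole `𝓑'` of level `≤ s'` whose Kerr-ness (d.o.c. `C^∞`-isometric to a subextremal Kerr
exterior, verbatim the crux conclusion) implies that of `𝓑`.  Intended witness: the refuters' level-deflation surgery made into a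
proof device (item evidence EVIDENCE.md/EVIDENCE2.md, KerrLevel.lean: Kerr polar caps realise every positive level with d.o.c. the
full Kerr exterior) — Rácz–Wald bifurcate past extension of a stationary neighbourhood of the generator through `p₀`
(doi:10.1088/0264-9381/9/12/008, doi:10.1088/0264-9381/13/3/017), a Cauchy slice ducking under the bifurcation surface, excision of
the closed stationary future set through the complementary generators; the d.o.c. `I⁺(M_ext) ∩ I⁻(M_ext)` is untouched, so the
implication is transport of structure along the identity of the d.o.c.  Why it might fail: the Rácz–Wald extension is proved for
Killing horizons with compact cross-sections and must be localised to a neighbourhood of one generator inside the typed class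
(global hyperbolicity and the Cauchy clause of the excised extension, `I⁺`-regularity caveat CC08 Def. 1.1); under the proposed
repair C′ of the crux (compact `Set.range 𝓑.embed ∩ 𝓔⁺`, `𝓔⁺ ⊆` orbit of it) the surgery is blocked and this stub becomes false —
it is a stub of the crux AS TYPED (rev 3).  Sources: refuter evidence on stmt-FinalStateConjecture-10825; Rácz–Wald 1992/1996;
Chruściel–Costa arXiv:0806.0016 §2; AIK arXiv:1304.0487 (1.5). -/
theorem stub_levelDeflation : open Literature.Geometry.Lorentzian in open scoped Manifold in ∀ (𝓑 : StationaryAFBlackHole.{0}) [𝓑.metric.HasLeviCivita] [Kerr.Facts] (hF : 𝓑.metric.isOpen_chronologicalFuture 𝓑.timeOrientation) (hP : 𝓑.metric.isOpen_chronologicalPast 𝓑.timeOrientation), 𝓑.metric.IsGloballyHyperbolic 𝓑.timeOrientation → 𝓑.metric.IsCauchyHypersurface 𝓑.timeOrientation (Set.range 𝓑.embed) → IsConnected 𝓑.horizon → 𝓑.toSpacetime.IsNonDegenerateHorizon 𝓑.Mext → Filter.Tendsto (fun x ↦ 𝓑.metric.val (𝓑.embed x) (𝓑.killing (𝓑.embed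 x)) (𝓑.killing (𝓑.embed x))) (⨅ R : ℝ, Filter.principal (𝓑.e.far R)) (nhds (-1)) → 𝓑.metric.toPseudoRiemannianMetric.IsRicciFlat → ∀ s' : ℝ, 0 < s' → (∃ p₀ ∈ 𝓑.horizon, 𝓑.metric.val p₀ (𝓑.killing p₀) (𝓑.killing p₀) < s') → ∃ (𝓑' : StationaryAFBlackHole.{0}) (_ : 𝓑'.metric.HasLeviCivita) (hF' : 𝓑'.metric.isOpen_chronologicalFuture 𝓑'.timeOrientation) (hP' : 𝓑'.metric.isOpen_chronologicalPast 𝓑'.timeOrientation), 𝓑'.metric.IsGloballyHyperbolic 𝓑'.timeOrientation ∧ 𝓑'.metric.IsCauchyHypersurface 𝓑'.timeOrientation (Set.range 𝓑'.embed) ∧ IsConnected 𝓑'.horizon ∧ 𝓑'.toSpacetime.IsNonDegenerateHorizon 𝓑'.Mext ∧ Filter.Tendsto (fun x ↦ 𝓑'.metric.val (𝓑'.embed x) (𝓑'.killing (𝓑'.embed x)) (𝓑'.killing (𝓑'.embed x))) (⨅ R : ℝ, Filter.principal (𝓑'.e.far R)) (nhds (-1)) ∧ 𝓑'.metric.toPseudoRiemannianMetric.IsRicciFlat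 ∧ (∀ p ∈ 𝓑'.horizon, 𝓑'.metric.val p (𝓑'.killing p) (𝓑'.killing p) ≤ s') ∧ ((∃ (M a : ℝ) (_ : Kerr.IsSubextremal M a) (Φ : Diffeomorph (𝓡 4) 𝓘(ℝ, E4) (𝓑'.docOpens hF' hP') (Kerr.exterior M a) ((⊤ : ℕ∞) : WithTop ℕ∞)), ∀ (y : 𝓑'.docOpens hF' hP') (v w : EuclideanSpace ℝ (Fin 4)), (Kerr.smoothMetric M a (Kerr.rPlus M a)).val (Φ y) (mfderiv (𝓡 4) 𝓘(ℝ, E4) Φ y v) (mfderiv (𝓡 4) 𝓘(ℝ, E4) Φ y w) = 𝓑'.metric.val y.1 v w) → (∃ (M a : ℝ) (_ : Kerr.IsSubextremal M a) (Φ : Diffeomorph (𝓡 4) 𝓘(ℝ, E4) (𝓑.docOpens hF hP) (Kerr.exterior M a) ((⊤ : ℕ∞) : WithTop ℕ∞)), ∀ (y : 𝓑.docOpens hF hP) (v w : EuclideanSpace ℝ (Fin 4)), (Kerr.smoothMetric M a (Kerr.rPlus M a)).val (Φ y) (mfderiv (𝓡 4) 𝓘(ℝ, E4) Φ y v) (mfderiv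 (𝓡 4) 𝓘(ℝ, E4) Φ y w) = 𝓑.metric.val y.1 v w)) := by
  sorry

/-- **S — SUBLUMINAL HORIZON COROTATION** (size M/L; a geometric inequality of independent interest).  Every
typed-regular Ricci-flat stationary AF hole with connected non-degenerate horizon and `T` normalised at the end has horizon
rotation level uniformly below `1`: `∃ s₁ < 1, g(T,T) ≤ s₁` on `𝓔⁺`.  Along Kerr, `sup_𝓔⁺ g(T,T) = a²/r₊² = (Ω_H R_eq)²` and
`a²/r₊² < 1 ⟺ |a| < M` (refuter's KerrLevel.lean: `horizonLevel ≤ a²/r₊²`); in general `g(T,T)|𝓔⁺ = |T − K-part|²` is the squared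
corotation speed of the horizon relative to the stationary frame at infinity, and the claim is that a NON-DEGENERATE (`κ ≠ 0`)
horizon corotates subluminally.  It is a consequence of the target GradedNoHair (sup of `g_tt` over the closure of a subextremal
Kerr exterior is `a²/r₊²`), used here to confine the isolevel residue to `0 < s < 1`.  Why it might fail: no proof in print off
Kerr; a distorted or exotic non-degenerate horizon could corotate at speed `≥ 1` far from the axis (only `J`–`A`-type
inequalities are known: Hennig–Ansorg–Cederbaum arXiv:0805.4320, Dain–Reiris arXiv:1102.5215); typed pathologies (horizon pieces
glued at `t → ∞`) are covered only through the target.  Sources: arXiv:1304.0487 (1.5); arXiv:0805.4320; arXiv:1102.5215;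
KerrLevel.lean (item evidence). -/
theorem stub_subluminalHorizon : open Literature.Geometry.Lorentzian in open scoped Manifold in ∀ (𝓑 : StationaryAFBlackHole.{0}) [𝓑.metric.HasLeviCivita], 𝓑.metric.IsGloballyHyperbolic 𝓑.timeOrientation → 𝓑.metric.IsCauchyHypersurface 𝓑.timeOrientation (Set.range 𝓑.embed) → IsConnected 𝓑.horizon → 𝓑.toSpacetime.IsNonDegenerateHorizon 𝓑.Mext → Filter.Tendsto (fun x ↦ 𝓑.metric.val (𝓑.embed x) (𝓑.killing (𝓑.embed x)) (𝓑.killing (𝓑.embed x))) (⨅ R : ℝ, Filter.principal (𝓑.e.far R)) (nhds (-1)) → 𝓑.metric.toPseudoRiemannianMetric.IsRicciFlat → ∃ s₁ : ℝ, s₁ < 1 ∧ ∀ p ∈ 𝓑.horizon, 𝓑.metric.val p (𝓑.killing p) (𝓑.killing p) ≤ s₁ := by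
  sorry

/-- **I — ISOLEVEL RIGIDITY** (the rigidity residue of the crux as typed; open-problem sized but thin).  For
`0 < s < 1`: a typed-regular Ricci-flat hole whose horizon level function is CONSTANT, `g(T,T) ≡ s` on `𝓔⁺` (an isorotating
non-degenerate horizon: no generator of lower level, so no deflation and the induction hypothesis is mute), has d.o.c.
`C^∞`-isometric to a subextremal Kerr exterior.  Under the target this case is (nearly) vacuous — on a Kerr horizon
`g(T,T) = a² sin²θ/(r₊² + a² cos²θ)` is constant on no open set of generators unless `a = 0`, where it is `0 < s` — so the stub
says: an exotic hole cannot hide at a first level by corotating rigidly.  Why it might fail: it is a genuine slice of smooth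
black-hole rigidity (CCH12 Conj. 3.4) for a codimension-∞ class; near-horizon (characteristic) data with `|T − K-part|² ≡ s` are
locally unobstructed in the smooth category (Ionescu–Klainerman non-extension germs, arXiv:1108.3575), so only a GLOBAL argument
can decide it.  Sources: arXiv:1205.6112 §3.4; arXiv:1108.3575; arXiv:1304.0487. -/
theorem stub_isolevelRigidity : open Literature.Geometry.Lorentzian in open scoped Manifold in ∀ s : ℝ, 0 < s → s < 1 → ∀ (𝓑 : StationaryAFBlackHole.{0}) [𝓑.metric.HasLeviCivita] [Kerr.Facts] (hF : 𝓑.metric.isOpen_chronologicalFuture 𝓑.timeOrientation) (hP : 𝓑.metric.isOpen_chronologicalPast 𝓑.timeOrientation), 𝓑.metric.IsGloballyHyperbolic 𝓑.timeOrientation → 𝓑.metric.IsCauchyHypersurface 𝓑.timeOrientation (Set.range 𝓑.embed) → IsConnected 𝓑.horizon → 𝓑.toSpacetime.IsNonDegenerateHorizon 𝓑.Mext → Filter.Tendsto (fun x ↦ 𝓑.metric.val (𝓑.embed x) (𝓑.killing (𝓑.embed x)) (𝓑.killing (𝓑.embed x))) (⨅ R : ℝ, Filter.principal (𝓑.e.far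 R)) (nhds (-1)) → (∀ p ∈ 𝓑.horizon, 𝓑.metric.val p (𝓑.killing p) (𝓑.killing p) = s) → 𝓑.metric.toPseudoRiemannianMetric.IsRicciFlat → ∃ (M a : ℝ) (_ : Kerr.IsSubextremal M a) (Φ : Diffeomorph (𝓡 4) 𝓘(ℝ, E4) (𝓑.docOpens hF hP) (Kerr.exterior M a) ((⊤ : ℕ∞) : WithTop ℕ∞)), ∀ (y : 𝓑.docOpens hF hP) (v w : EuclideanSpace ℝ (Fin 4)), (Kerr.smoothMetric M a (Kerr.rPlus M a)).val (Φ y) (mfderiv (𝓡 4) 𝓘(ℝ, E4) Φ y v) (mfderiv (𝓡 4) 𝓘(ℝ, E4) Φ y w) = 𝓑.metric.val y.1 v w := by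
  sorry


/-! ## Composition: the crux BY NAME from the three stubs (real proof, no `sorry`) -/

/-- **ClosedUnderRotation from D, S, I** — case analysis on the horizon level function of the hole at hand: a slower generator
is deflated below `s` and handed to the induction hypothesis (D); otherwise the horizon is isolevel, subluminal by S, and I
applies. -/
theorem ClosedUnderRotation_of :
    Sig.stub_levelDeflation → Sig.stub_subluminalHorizon → Sig.stub_isolevelRigidity → ClosedUnderRotation := by
  intro hD hS hI s hs hIH 𝓑 _ _ hF hP hgh hcs hconn hnd hfar hlev hvac
  by_cases hlow : ∃ p₀ ∈ 𝓑.horizon, 𝓑.metric.val p₀ (𝓑.killing p₀) (𝓑.killing p₀) < s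
  · -- (B1) a slower generator: deflate to the intermediate level `s'` and use the induction hypothesis there
    obtain ⟨p₀, hp₀, hlt⟩ := hlow
    have hm : max (𝓑.metric.val p₀ (𝓑.killing p₀) (𝓑.killing p₀)) 0 < s := max_lt hlt hs
    have hm0 : 0 ≤ max (𝓑.metric.val p₀ (𝓑.killing p₀) (𝓑.killing p₀)) 0 := le_max_right _ _
    have hpm : 𝓑.metric.val p₀ (𝓑.killing p₀) (𝓑.killing p₀) ≤
        max (𝓑.metric.val p₀ (𝓑.killing p₀) (𝓑.killing p₀)) 0 := le_max_left _ _
    obtain ⟨s', hs'0, hs'pos, hs's, hps'⟩ : ∃ s' : ℝ, 0 ≤ s' ∧ 0 < s' ∧ s' < s ∧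
        𝓑.metric.val p₀ (𝓑.killing p₀) (𝓑.killing p₀) < s' :=
      ⟨(max (𝓑.metric.val p₀ (𝓑.killing p₀) (𝓑.killing p₀)) 0 + s) / 2,
        by linarith, by linarith, by linarith, by linarith⟩
    obtain ⟨𝓑', _, hF', hP', hgh', hcs', hconn', hnd', hfar', hvac', hlev', himp⟩ :=
      hD 𝓑 hF hP hgh hcs hconn hnd hfar hvac s' hs'pos ⟨p₀, hp₀, hps'⟩
    exact himp (hIH s' hs'0 hs's 𝓑' hF' hP' hgh' hcs' hconn' hnd' hfar' hlev' hvac')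
  · -- (B2) isolevel horizon: subluminal by S, then I
    push Not at hlow
    have hconst : ∀ p ∈ 𝓑.horizon, 𝓑.metric.val p (𝓑.killing p) (𝓑.killing p) = s :=
      fun p hp ↦ le_antisymm (hlev p hp) (hlow p hp)
    obtain ⟨s₁, hs₁, hle₁⟩ := hS 𝓑 hgh hcs hconn hnd hfar hvac
    obtain ⟨p, hp⟩ := hconn.nonempty
    have hs1 : s < 1 := by
      have h := hle₁ p hp
      rw [hconst p hp] at h
      exact lt_of_le_of_lt h hs₁
    exact hI s hs hs1 𝓑 hF hP hgh hcs hconn hnd hfar hconst hvac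

/-- The crux by name, closed modulo the three registered stubs. -/
theorem closedUnderRotation_of_stubs : ClosedUnderRotation :=
  ClosedUnderRotation_of stub_levelDeflation stub_subluminalHorizon stub_isolevelRigidity

end Summit.FinalStateConjecture.FinalStateConjecture.Cruxes.ClosedUnderRotation.Birth

end
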